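import Mathlib
import Summits.KontsevichZagierPeriods.KontsevichZagierPeriods.Theorems.SoloInformedZetaFourPieces
import HarnessLib
import HarnessLib.Audit

/-!
# SoloInformed — weight 4: duality `mzvClass [2,1,1] = mzvClass [4]` as two naive moves

Solo programme `solo-KontsevichZagierPeriods-informed`, session s45 (PART XVI). The duality
`ζ(2,1,1) = ζ(4)` (`t ↦ (1 − t₃, 1 − t₂, 1 − t₁, 1 − t₀)` on Kontsevich's simplex) is realised inside
`KZ.relations` as TWO rule-(2) moves between the Literature's simplex representations
`KZ.mzvRep [4]` and `KZ.mzvRep [2,1,1]`: the coordinate reversal (`IntegralRep.reindex`,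
`KZ.of_sub_of_reindex_mem_relations`) followed by the reflection `t ↦ 1 − t` in every coordinate
(a polynomial substitution with Jacobian determinant `1`).

Main results: `soloInformed_Z4_sub_Z211 : of (mzvRep [4]) − of (mzvRep [2,1,1]) ∈ KZ.relations`,
`soloInformed_mzvClass_duality4 : mzvClass [2,1,1] = mzvClass [4]`.
-/

noncomputable section

open MeasureTheory Set MvPolynomial
open Literature.ModelTheory.ExponentialFields Literature.NumberTheory.Transcendental
open Literature.NumberTheory.Transcendental.KZ

namespace Summit.KontsevichZagierPeriods.KontsevichZagierPeriods.Theorems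

/-! ## 1. `Z(2,1,1)` -/


/-- **`Z(2,1,1) = KZ.mzvRep [2,1,1]`** (word `0111`). -/
def soloInformedZ211 : IntegralRep 4 :=
  mzvRep [2, 1, 1] (by decide : MZV.IsAdmissible [2, 1, 1]) (mzvIntegrand_isSemialgebraicFunOn_holds _)
    (mzvIntegrand_integrableOn_holds _ (by decide : MZV.IsAdmissible [2, 1, 1]))

/-- `⟦Z(2,1,1)⟧ = mzvClass [2,1,1]`. -/
theorem soloInformed_toFormalPeriod_Z211 :
    toFormalPeriod (of soloInformedZ211) = mzvClass [2, 1, 1] :=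
  (mzvClass_of_isAdmissible (by decide : MZV.IsAdmissible [2, 1, 1])).symm

/-- Domain of `Z(2,1,1)`. -/
@[simp] theorem soloInformedZ211_domain : soloInformedZ211.domain = openOrderedSimplex 4 := rfl

/-- The integrand of `Z(2,1,1)`. -/
theorem soloInformedZ211_integrand (t : Fin 4 → ℝ) :
    soloInformedZ211.integrand t =
      1 / t 0 * (1 / (1 - t 1)) * (1 / (1 - t 2)) * (1 / (1 - t 3)) := by
  show ∏ i : Fin 4, mzvForm ((MZV.binaryWord [2, 1, 1]).getD i false) (t i) = _
  rw [Fin.prod_univ_four, show MZV.binaryWord [2, 1, 1] = [false, true, true, true] from rfl]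
  simp [mzvForm]

/-! ## 2. The coordinate reversal -/

/-- The reversal `(0,1,2,3) ↦ (3,2,1,0)`. -/
def soloInformedRev4 : Fin 4 ≃ Fin 4 := ⟨![3, 2, 1, 0], ![3, 2, 1, 0], by decide, by decide⟩

/-- Values of the reversal. -/
@[simp] theorem soloInformedRev4_zero : soloInformedRev4 0 = 3 := rfl
/-- Auxiliary. -/
@[simp] theorem soloInformedRev4_one : soloInformedRev4 1 = 2 := rfl
/-- Auxiliary. -/
@[simp] theorem soloInformedRev4_two : soloInformedRev4 2 = 1 := rfl
/-- Auxiliary. -/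
@[simp] theorem soloInformedRev4_three : soloInformedRev4 3 = 0 := rfl

/-- The reversed simplex is the increasing simplex. -/
theorem soloInformed_rev4_domain :
    (soloInformedZ4.reindex soloInformedRev4).domain =
      soloInformedOpenCube 4 ∩ ({t | t 0 < t 1} ∩ {t | t 1 < t 2} ∩ {t | t 2 < t 3}) := by
  rw [IntegralRep.reindex_domain, soloInformedZ4_domain, soloInformed_openOrderedSimplex4_eq]
  ext w
  simp only [mem_setOf_eq, soloInformed_mem_nabla4, soloInformed_comp_mem_openCube_iff,
    soloInformedRev4_zero, soloInformedRev4_one, soloInformedRev4_two, soloInformedRev4_three,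
    mem_inter_iff, and_assoc]
  constructor
  · rintro ⟨hc, h1, h2, h3⟩; exact ⟨hc, h3, h2, h1⟩
  · rintro ⟨hc, h1, h2, h3⟩; exact ⟨hc, h3, h2, h1⟩

/-! ## 3. The reflection `t ↦ 1 − t` -/

/-- The polynomial components of the reflection. -/
def soloInformedReflPoly : Fin 4 → MvPolynomial (Fin 4) ℚ := fun j => 1 - X j

/-- The reflection `ρ(t) = (1 − t₀, 1 − t₁, 1 − t₂, 1 − t₃)`. -/
def soloInformedRefl : (Fin 4 → ℝ) → Fin 4 → ℝ := soloInformedPolyMap soloInformedReflPoly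

/-- `ρ(t)ⱼ = 1 − tⱼ`. -/
@[simp] theorem soloInformedRefl_apply (t : Fin 4 → ℝ) (j : Fin 4) :
    soloInformedRefl t j = 1 - t j := by
  simp [soloInformedRefl, soloInformedReflPoly, soloInformedPolyMap]

/-- `det J_ρ = 1`. -/
theorem soloInformed_det_refl (t : Fin 4 → ℝ) :
    (soloInformedJacCLM soloInformedReflPoly t).det = 1 := by
  rw [soloInformed_det_jacCLM]
  simp [Matrix.det_succ_row_zero, Fin.sum_univ_succ, soloInformedReflPoly, pderiv_X,
    Pi.single_apply, Fin.succAbove]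

/-- `ρ` is injective. -/
theorem soloInformed_injOn_refl (s : Set (Fin 4 → ℝ)) : InjOn soloInformedRefl s := by
  intro t _ t' _ h
  ext j
  have := congr_fun h j
  simp only [soloInformedRefl_apply] at this
  linarith

/-- `ρ` maps the increasing simplex onto Kontsevich's (decreasing) simplex. -/
theorem soloInformed_image_refl :
    soloInformedRefl '' (soloInformedOpenCube 4 ∩ ({t | t 0 < t 1} ∩ {t | t 1 < t 2} ∩ {t | t 2 < t 3}))
      = openOrderedSimplex 4 := by
  rw [soloInformed_openOrderedSimplex4_eq]
  refine Subset.antisymm ?_ fun t ht => ?_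
  · rintro _ ⟨w, ⟨hw, ⟨⟨h01, h12⟩, h23⟩⟩, rfl⟩
    have h01' : w 0 < w 1 := h01
    have h12' : w 1 < w 2 := h12
    have h23' : w 2 < w 3 := h23
    refine soloInformed_mem_nabla4.2 ⟨fun j => ?_, ?_, ?_, ?_⟩
    · rw [soloInformedRefl_apply]; exact ⟨by linarith [(hw j).2], by linarith [(hw j).1]⟩
    · rw [soloInformedRefl_apply, soloInformedRefl_apply]; linarith
    · rw [soloInformedRefl_apply, soloInformedRefl_apply]; linarith
    · rw [soloInformedRefl_apply, soloInformedRefl_apply]; linarith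
  · obtain ⟨hc, h10, h21, h32⟩ := soloInformed_mem_nabla4.1 ht
    refine ⟨fun j => 1 - t j, ⟨fun j => ⟨by linarith [(hc j).2], by linarith [(hc j).1]⟩,
      ⟨⟨?_, ?_⟩, ?_⟩⟩, ?_⟩
    · show 1 - t 0 < 1 - t 1
      linarith
    · show 1 - t 1 < 1 - t 2
      linarith
    · show 1 - t 2 < 1 - t 3
      linarith
    · ext j; rw [soloInformedRefl_apply]; ring

/-! ## 4. The two moves and the duality -/

/-- **`[Z(4)∘rev] − [Z(2,1,1)] ∈ relations`** (the reflection move). -/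
theorem soloInformed_rev4_sub_Z211 :
    of (soloInformedZ4.reindex soloInformedRev4) - of soloInformedZ211 ∈ relations := by
  refine soloInformed_of_sub_of_mem_relations_polyMapCLM soloInformedReflPoly _ _
    (by rw [soloInformed_rev4_domain]; exact soloInformed_injOn_refl _)
    (by rw [soloInformed_rev4_domain, soloInformedZ211_domain]; exact soloInformed_image_refl.symm)
    fun w hw => ?_
  rw [soloInformed_rev4_domain] at hw
  have h0 := hw.1 0; have h1 := hw.1 1; have h2 := hw.1 2; have h3 := hw.1 3
  rw [soloInformed_det_refl, abs_one, mul_one,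
    show soloInformedPolyMap soloInformedReflPoly w = soloInformedRefl w from rfl,
    soloInformedZ211_integrand]
  simp only [IntegralRep.reindex_integrand, soloInformedZ4_integrand, soloInformedRev4_zero,
    soloInformedRev4_one, soloInformedRev4_two, soloInformedRev4_three, soloInformedRefl_apply,
    sub_sub_cancel]
  ring

/-- **THEOREM (duality at weight 4 by two naive moves).** `[Z(4)] − [Z(2,1,1)] ∈ KZ.relations`. -/
theorem soloInformed_Z4_sub_Z211 : of soloInformedZ4 - of soloInformedZ211 ∈ relations := by
  have h1 := of_sub_of_reindex_mem_relations soloInformedZ4 soloInformedRev4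
  have h : of soloInformedZ4 - of soloInformedZ211 = (of soloInformedZ4
      - of (soloInformedZ4.reindex soloInformedRev4))
      + (of (soloInformedZ4.reindex soloInformedRev4) - of soloInformedZ211) := by abel
  rw [h]
  exact relations.add_mem h1 soloInformed_rev4_sub_Z211

/-- **COROLLARY.** `mzvClass [2,1,1] = mzvClass [4]` in the formal period ring. -/
theorem soloInformed_mzvClass_duality4 : mzvClass [2, 1, 1] = mzvClass [4] := by
  rw [← soloInformed_toFormalPeriod_Z211, ← soloInformed_toFormalPeriod_Z4, toFormalPeriod_eq_iff]
  have h := relations.neg_mem soloInformed_Z4_sub_Z211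
  rwa [neg_sub] at h

/-! *Remark.* Applying `KZ.evalP` gives the numerical duality `multipleZeta [2,1,1] = multipleZeta [4]`
(in the Literature: `multipleZeta_duality`, `multipleZeta_two_one_one`, `multipleZeta_four`); the
content here is the lift to `𝒫`. -/

end Summit.KontsevichZagierPeriods.KontsevichZagierPeriods.Theorems
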